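import Summits.ABC.IUTFork.Conditional.AbcOfSGenuineMShrink2
import Summits.ABC.IUTFork.Conditional.AbcOfSlackRegimeSzpiro
import Summits.ABC.IUTFork.LDHGenuineHullRegimeMixedPoint
import HarnessLib

/-!
# Branch C certificate v10, CONE RE-CUT: the M-line apex `abc_of_SH_v10M` (abc-iut-s2-p12 p442072 ✓: 2 explicit = `hSH` · `hreg`) with its
# (P,l)-level CONE binder replaced by each LANDED cut / datum-free sufficient condition of the TARGET #1 residue — at equal explicit count 2

R2 S-CHAIN TEAM seat abc-iut-s2-p10 (minted target «hQPin by construction» closed on every line: p432576 ✓ / p437093 ✓ / p437376 ✓ / p440759 ✓,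
folded into v9M/v10M by `rfl`; this file = «float to TARGET #1»: the CONE re-cut of the lineage p434025 ✓ / p436259 ✓ / p437093 ✓, now on the
M-line). PROOF-ONLY (no `def`, no new `Prop`, no instance, no notation); nothing re-typed: every hypothesis below is a binder copied BYTE-FOR-BYTE
from the landed theorem it is fed to, and every proof is a composition BY NAME.

* §1 `GenuineMShrink2.cor312AtDatum_of_SH` — the [S_H] family of `abc_of_SH_v10M` (hull-level printed clause at the summand-route M-level sharp
  setting of each ADMISSIBLE datum's own ideles, PINNED reading `ρ := fun _ => P.qRegion`, free `qK`) ALONE gives `Cor22.Cor312AtDatum P l` at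
  every admissible `(P, l)` — the `h312` slot of EVERY (U)-line capstone in the tree (`ThetaPartII.ABC_of_cor312_of_hullRegime` p428563,
  `…_of_hullRegimeAbove`, `Conditional.ABC_of_cor312_of_slackRegime` p434025, `…_of_szpiroSlackRegime` p436259, `…_of_szpiroSuff`,
  `…_of_pointMixedSzpiro` p438083), so any present or future cone cut composes in ONE line.
  Proof: abc-iut-s2-p12's per-datum theorem `GenuineMShrink2.cor312Of_of_SH` (p442072) at `T.D`, `T.isVolumeInputOf`.
* §2 three apexes, each `= <landed (U)-capstone> (§1 hSH) <its cone binder>`: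
  - `abc_of_SH_v10M_szpiroSlack` — CONE := `hresSz` (`Conditional/AbcOfSlackRegimeSzpiro.lean` p436259: the hull estimate with `B_III(P,l)` ONLY
    at non-slot-constant data of points with `2 ≤ d_mod` ABOVE abc-iut-c312-d1's explicit height threshold whose (Ind1) slot residue EXCEEDS
    abc-iut-s2-p1's Szpiro slack) — the STRONGEST landed cut (`hreg ⟹ habove ⟹ hresSz` as hypotheses); the M-line twin of abc-iut-C-cert-2's
    K-line `abc_of_SH_v7K_szpiroSlack` (p440821). Tail `Conditional.ABC_of_cor312_of_szpiroSlackRegime`.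
  - `abc_of_SH_v10M_szpiroSuff` — CONE := abc-iut-s2-p1's DATUM-FREE Szpiro-type inequality `hSz` at `d_mod ≥ 2`
    (`Conditional/AbcOfSHvolSzpiroSuff.lean`; `d_mod = 1` is abc-iut-S3's pinned theorem inside). Tail `Conditional.ABC_of_cor312_of_szpiroSuff`.
  - `abc_of_SH_v10M_pointMixedSzpiro` — CONE := abc-iut-s2-p1's DATUM-FREE mixed-height bound `hMix` (`LDHGenuineHullRegimeMixedPoint.lean`
    p438083, TRADE 6 of HOME/s2/SCOREBOARD.md). Tail `Conditional.ABC_of_cor312_of_pointMixedSzpiro`.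
  Explicit count of each apex: 2 = S_H 1 + CONE 1 (PIN 0 · ORBIT 0 · PROV 0 · BRIDGE 0 · READ 0 · SIDE 0 · FACT 0, as v10M).

WHAT THIS SAYS (numbers, not adjectives): on the M-line the kernel needs, besides [S_H], exactly ONE (P,l)-level input, and that input may be
taken in any of the three landed currencies above; `hSz` / `hMix` are abc/Szpiro-TYPE inequalities for the `λ`-line points of `d_mod ≥ 2`
(statements of the same type as the conclusion — the TARGET #1 residue is Szpiro-type in both directions: sufficiency here, necessity
abc-iut-s2-p1 p438393 / abc-iut-s2-p4 p434756 / abc-iut-w6-d018 p433633); `hresSz` is the residue locus where no landed estimate applies.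
STATUS OF hSH (unchanged, not a target): S_H as typed = per-packet SET inclusion at the sharp boxes, STRONGER THAN PRINT at [IUTchIII] p. 184
(VERDICT §D); kernel-refuted at deep data on the K-line (`Conditional.not_hSH_v6K_of_exists_deep` p438886) and inhabited in the shallow tame
window (p439445) — the certificate LOCATES, it does not adjudicate.
HONEST FRAMING: this campaign LOCATES / CONDITIONALLY VERIFIES. Nothing here asserts that abc is proved or refuted, that [IUTchIII] Cor. 3.12 /
Thm. 3.11 or [IUTchIV] Thm. 1.10 holds or fails at any datum, or takes a side on any author (Mochizuki / Scholze–Stix / Joshi / Dupuy–Hilado);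
«`ABC` follows from S_H + the named cone input AS TYPED, at these data», nothing more; typed ≠ proved; instantiated ≠ endorsed.
[claim: Mochizuki2012, status: disputed] [cite: Mochizuki2012, IUTchIII Cor. 3.12 p. 173–174, Step (xi-d) p. 183, (xi-f) p. 184; IUTchIV
Thm. 1.10 Steps (ii)–(viii) p. 24–30, Cor. 2.2 (ii) p. 45–46] [cite: DupuyHilado2025, §3.4, §3.9, Thm. 3.10.1]
-/

noncomputable section

open Set Function NumberField IsDedekindDomain

namespace Summit.ABC.IUTFork.Conditional

open Thm311 Thm311.Real Cor312 Cor312Vol Cor312Prov Literature.IUT.LogThetaLattice Literature.IUT.LogVolume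
  Literature.IUT.HodgeTheaters Literature.IUT.LogVolume.ThetaData Literature.NumberTheory.NumberFields
open Literature.NumberTheory.DiophantineGeometry.GenEll Summit.ABC.ABC.Theorems

section Family

/-! ## §0. DATA of the family — v10M's context binders VERBATIM, as section variables: per `λ`-line point `P`, prime `l` and genuine
Θ-volume datum `T`, the context binders of abc-iut-s2-p8's summand-route M-level sharp setting `settingPrVolSharpM T.D …` (logs FIXED:
analytic), the column data and PR-1's uninterpreted q-datum `qK` — NO `ρ` (pinned), NO pilot-data / provenance / field / idele binder -/

variable
    (M : ∀ (P : NFPoint) (l : ℕ) (T : Cor22.ThetaVolumeDatumAt P l), Type) [∀ P l T, Field (M P l T)] [∀ P l T, NumberField (M P l T)]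
    (archPk : ∀ (P : NFPoint) (l : ℕ) (T : Cor22.ThetaVolumeDatumAt P l), letI := T.instFieldF; letI := T.instNumberFieldF; letI := T.instAlgebraF; letI := T.instFieldK;
        letI := T.instNumberFieldK; letI := T.instAlgebraK; letI := T.instFieldFbar; letI := T.instAlgebraFbar;
        letI := T.instAlgebraKFbar; letI := T.instIsElliptic;
      ∀ (j : (thetaIndexOfInitial T.D).Label) (vQ : (thetaIndexOfInitial T.D).VQ), Set ((logShellsOfInitialDH T.D (analyticLogvVal T.K)).Packet j vQ))
    (archSub : ∀ (P : NFPoint) (l : ℕ) (T : Cor22.ThetaVolumeDatumAt P l), letI := T.instFieldF; letI := T.instNumberFieldF; letI := T.instAlgebraF; letI := T.instFieldK;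
        letI := T.instNumberFieldK; letI := T.instAlgebraK; letI := T.instFieldFbar; letI := T.instAlgebraFbar;
        letI := T.instAlgebraKFbar; letI := T.instIsElliptic;
      ∀ (j : (thetaIndexOfInitial T.D).Label) (v : (thetaIndexOfInitial T.D).V), Set ((logShellsOfInitialDH T.D (analyticLogvVal T.K)).Packet j ((thetaIndexOfInitial T.D).over v)))
    (Ψ : ∀ (P : NFPoint) (l : ℕ) (T : Cor22.ThetaVolumeDatumAt P l), letI := T.instFieldF; letI := T.instNumberFieldF; letI := T.instAlgebraF; letI := T.instFieldK;
        letI := T.instNumberFieldK; letI := T.instAlgebraK; letI := T.instFieldFbar; letI := T.instAlgebraFbar;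
        letI := T.instAlgebraKFbar; letI := T.instIsElliptic;
      ℤ → ∀ v : (thetaIndexOfInitial T.D).V, v ∈ (thetaIndexOfInitial T.D).Vbad → Set ((logShellsOfInitialDH T.D (analyticLogvVal T.K)).StarPacket v))
    (act : ∀ (P : NFPoint) (l : ℕ) (T : Cor22.ThetaVolumeDatumAt P l), letI := T.instFieldF; letI := T.instNumberFieldF; letI := T.instAlgebraF; letI := T.instFieldK;
        letI := T.instNumberFieldK; letI := T.instAlgebraK; letI := T.instFieldFbar; letI := T.instAlgebraFbar;
        letI := T.instAlgebraKFbar; letI := T.instIsElliptic;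
      ℤ → ∀ v : (thetaIndexOfInitial T.D).V, v ∈ (thetaIndexOfInitial T.D).Vbad → (logShellsOfInitialDH T.D (analyticLogvVal T.K)).StarPacket v → Module.End ℚ ((logShellsOfInitialDH T.D (analyticLogvVal T.K)).StarPacket v))
    (Mmod : ∀ (P : NFPoint) (l : ℕ) (T : Cor22.ThetaVolumeDatumAt P l), letI := T.instFieldF; letI := T.instNumberFieldF; letI := T.instAlgebraF; letI := T.instFieldK;
        letI := T.instNumberFieldK; letI := T.instAlgebraK; letI := T.instFieldFbar; letI := T.instAlgebraFbar;
        letI := T.instAlgebraKFbar; letI := T.instIsElliptic;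
      ℤ → ∀ j : (thetaIndexOfInitial T.D).LabelStar, Set ((logShellsOfInitialDH T.D (analyticLogvVal T.K)).GlobalPacket j.1))
    (region : ∀ (P : NFPoint) (l : ℕ) (T : Cor22.ThetaVolumeDatumAt P l), letI := T.instFieldF; letI := T.instNumberFieldF; letI := T.instAlgebraF; letI := T.instFieldK;
        letI := T.instNumberFieldK; letI := T.instAlgebraK; letI := T.instFieldFbar; letI := T.instAlgebraFbar;
        letI := T.instAlgebraKFbar; letI := T.instIsElliptic;
      ℤ → ∀ j : (thetaIndexOfInitial T.D).LabelStar, FinDivisor (M P l T) → ∀ vQ : (thetaIndexOfInitial T.D).VQ, Set ((logShellsOfInitialDH T.D (analyticLogvVal T.K)).Packet j.1 vQ))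
    (frobAdm : ∀ (P : NFPoint) (l : ℕ) (T : Cor22.ThetaVolumeDatumAt P l), letI := T.instFieldF; letI := T.instNumberFieldF; letI := T.instAlgebraF; letI := T.instFieldK;
        letI := T.instNumberFieldK; letI := T.instAlgebraK; letI := T.instFieldFbar; letI := T.instAlgebraFbar;
        letI := T.instAlgebraKFbar; letI := T.instIsElliptic;
      ℤ → ℤ → ∀ (j : (thetaIndexOfInitial T.D).Label) (vQ : (thetaIndexOfInitial T.D).VQ), Set ((logShellsOfInitialDH T.D (analyticLogvVal T.K)).Packet j vQ) → Prop)
    (frobLogvol : ∀ (P : NFPoint) (l : ℕ) (T : Cor22.ThetaVolumeDatumAt P l), letI := T.instFieldF; letI := T.instNumberFieldF; letI := T.instAlgebraF; letI := T.instFieldK;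
        letI := T.instNumberFieldK; letI := T.instAlgebraK; letI := T.instFieldFbar; letI := T.instAlgebraFbar;
        letI := T.instAlgebraKFbar; letI := T.instIsElliptic;
      ℤ → ℤ → ∀ (j : (thetaIndexOfInitial T.D).Label) (vQ : (thetaIndexOfInitial T.D).VQ), Set ((logShellsOfInitialDH T.D (analyticLogvVal T.K)).Packet j vQ) → ℝ)
    (frobΨ : ∀ (P : NFPoint) (l : ℕ) (T : Cor22.ThetaVolumeDatumAt P l), letI := T.instFieldF; letI := T.instNumberFieldF; letI := T.instAlgebraF; letI := T.instFieldK;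
        letI := T.instNumberFieldK; letI := T.instAlgebraK; letI := T.instFieldFbar; letI := T.instAlgebraFbar;
        letI := T.instAlgebraKFbar; letI := T.instIsElliptic;
      ℤ → ℤ → ∀ v : (thetaIndexOfInitial T.D).V, v ∈ (thetaIndexOfInitial T.D).Vbad → Set ((logShellsOfInitialDH T.D (analyticLogvVal T.K)).StarPacket v))
    (frobMmod : ∀ (P : NFPoint) (l : ℕ) (T : Cor22.ThetaVolumeDatumAt P l), letI := T.instFieldF; letI := T.instNumberFieldF; letI := T.instAlgebraF; letI := T.instFieldK;
        letI := T.instNumberFieldK; letI := T.instAlgebraK; letI := T.instFieldFbar; letI := T.instAlgebraFbar;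
        letI := T.instAlgebraKFbar; letI := T.instIsElliptic;
      ℤ → ℤ → ∀ j : (thetaIndexOfInitial T.D).LabelStar, Set ((logShellsOfInitialDH T.D (analyticLogvVal T.K)).GlobalPacket j.1))
    (unitImage : ∀ (P : NFPoint) (l : ℕ) (T : Cor22.ThetaVolumeDatumAt P l), letI := T.instFieldF; letI := T.instNumberFieldF; letI := T.instAlgebraF; letI := T.instFieldK;
        letI := T.instNumberFieldK; letI := T.instAlgebraK; letI := T.instFieldFbar; letI := T.instAlgebraFbar;
        letI := T.instAlgebraKFbar; letI := T.instIsElliptic;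
      ℤ → ℤ → ℕ → ∀ (j : (thetaIndexOfInitial T.D).Label) (vQ : (thetaIndexOfInitial T.D).VQ), Set ((logShellsOfInitialDH T.D (analyticLogvVal T.K)).Packet j vQ))
    (ballImage : ∀ (P : NFPoint) (l : ℕ) (T : Cor22.ThetaVolumeDatumAt P l), letI := T.instFieldF; letI := T.instNumberFieldF; letI := T.instAlgebraF; letI := T.instFieldK;
        letI := T.instNumberFieldK; letI := T.instAlgebraK; letI := T.instFieldFbar; letI := T.instAlgebraFbar;
        letI := T.instAlgebraKFbar; letI := T.instIsElliptic;
      ℤ → ℤ → ∀ (j : (thetaIndexOfInitial T.D).Label) (vQ : (thetaIndexOfInitial T.D).VQ), Set ((logShellsOfInitialDH T.D (analyticLogvVal T.K)).Packet j vQ))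
    (thetaDiv : ∀ (P : NFPoint) (l : ℕ) (T : Cor22.ThetaVolumeDatumAt P l), letI := T.instFieldF; letI := T.instNumberFieldF; letI := T.instAlgebraF; letI := T.instFieldK;
        letI := T.instNumberFieldK; letI := T.instAlgebraK; letI := T.instFieldFbar; letI := T.instAlgebraFbar;
        letI := T.instAlgebraKFbar; letI := T.instIsElliptic;
      ℤ → ℤ → LgpDivisor (M P l T) (thetaIndexOfInitial T.D).lstar)
    (n : ∀ (P : NFPoint) (l : ℕ) (T : Cor22.ThetaVolumeDatumAt P l), ℤ)
    {HT : ∀ (P : NFPoint) (l : ℕ) (T : Cor22.ThetaVolumeDatumAt P l), Type} {LogLink : ∀ (P : NFPoint) (l : ℕ) (T : Cor22.ThetaVolumeDatumAt P l), HT P l T → HT P l T → Type}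
    {IsFull : ∀ (P : NFPoint) (l : ℕ) (T : Cor22.ThetaVolumeDatumAt P l), ∀ {s t : HT P l T}, LogLink P l T s t → Prop}
    (lat : ∀ (P : NFPoint) (l : ℕ) (T : Cor22.ThetaVolumeDatumAt P l), LGPGaussianLogThetaLattice (LogLink P l T) (IsFull P l T))
    {Frd : ∀ (P : NFPoint) (l : ℕ) (T : Cor22.ThetaVolumeDatumAt P l), Type} {IsoF : ∀ (P : NFPoint) (l : ℕ) (T : Cor22.ThetaVolumeDatumAt P l), Frd P l T → Frd P l T → Type} {Ob : ∀ (P : NFPoint) (l : ℕ) (T : Cor22.ThetaVolumeDatumAt P l), Frd P l T → Type}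
    {realify : ∀ (P : NFPoint) (l : ℕ) (T : Cor22.ThetaVolumeDatumAt P l), Frd P l T → Frd P l T} {Strip : ∀ (P : NFPoint) (l : ℕ) (T : Cor22.ThetaVolumeDatumAt P l), Type} {IsoS : ∀ (P : NFPoint) (l : ℕ) (T : Cor22.ThetaVolumeDatumAt P l), Strip P l T → Strip P l T → Type}
    {Mv : ∀ (P : NFPoint) (l : ℕ) (T : Cor22.ThetaVolumeDatumAt P l), letI := T.instFieldF; letI := T.instNumberFieldF; letI := T.instAlgebraF; letI := T.instFieldK;
        letI := T.instNumberFieldK; letI := T.instAlgebraK; letI := T.instFieldFbar; letI := T.instAlgebraFbar;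
        letI := T.instAlgebraKFbar; letI := T.instIsElliptic;
      ∀ v : (thetaIndexOfInitial T.D).V, v ∈ (thetaIndexOfInitial T.D).Vbad → Type}
    [∀ P l T v h, Monoid (Mv P l T v h)]
    (sig : ∀ (P : NFPoint) (l : ℕ) (T : Cor22.ThetaVolumeDatumAt P l), letI := T.instFieldF; letI := T.instNumberFieldF; letI := T.instAlgebraF; letI := T.instFieldK;
        letI := T.instNumberFieldK; letI := T.instAlgebraK; letI := T.instFieldFbar; letI := T.instAlgebraFbar;
        letI := T.instAlgebraKFbar; letI := T.instIsElliptic;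
      GlobalLGPFrobenioidSignature (thetaIndexOfInitial T.D).lstar (thetaIndexOfInitial T.D).V (· ∈ (thetaIndexOfInitial T.D).Vbad) (Frd P l T) (IsoF P l T) (Ob P l T) (realify P l T)
        (Strip P l T) (IsoS P l T) (Mv P l T))
    (split : ∀ (P : NFPoint) (l : ℕ) (T : Cor22.ThetaVolumeDatumAt P l), SplittingMonoids (Mv P l T))
    {ObΔ : ∀ (P : NFPoint) (l : ℕ) (T : Cor22.ThetaVolumeDatumAt P l), Type}
    {N : ∀ (P : NFPoint) (l : ℕ) (T : Cor22.ThetaVolumeDatumAt P l), letI := T.instFieldF; letI := T.instNumberFieldF; letI := T.instAlgebraF; letI := T.instFieldK;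
        letI := T.instNumberFieldK; letI := T.instAlgebraK; letI := T.instFieldFbar; letI := T.instAlgebraFbar;
        letI := T.instAlgebraKFbar; letI := T.instIsElliptic;
      ∀ v : (thetaIndexOfInitial T.D).V, v ∈ (thetaIndexOfInitial T.D).Vbad → Type}
    [∀ P l T v h, Monoid (N P l T v h)] (qData : ∀ (P : NFPoint) (l : ℕ) (T : Cor22.ThetaVolumeDatumAt P l), QPilotData (ObΔ P l T) (N P l T))
    (qK : ∀ (P : NFPoint) (l : ℕ) (T : Cor22.ThetaVolumeDatumAt P l), letI := T.instFieldF; letI := T.instNumberFieldF; letI := T.instAlgebraF; letI := T.instFieldK;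
        letI := T.instNumberFieldK; letI := T.instAlgebraK; letI := T.instFieldFbar; letI := T.instAlgebraFbar;
        letI := T.instAlgebraKFbar; letI := T.instIsElliptic;
      ∀ v : (thetaIndexOfInitial T.D).V, v ∈ (thetaIndexOfInitial T.D).Vbad → Set ((logShellsOfInitialDH T.D (analyticLogvVal T.K)).StarPacket v))

/-! ## §1. The [S_H] family ALONE gives [IUTchIII] Cor. 3.12 at every admissible genuine Θ-volume datum (`Cor22.Cor312AtDatum`) -/

/-- **[S_H] family ⟹ `Cor22.Cor312AtDatum P l` at every ADMISSIBLE `(P, l)`** (`P ∈ UP`, `l` prime `≥ 5`, «admits an `F`-core», (P2),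
(P5), (P6)): the `h312` slot of every (U)-line capstone, from v10M's [S_H] binder VERBATIM (hull-level `Cor312Vol.PilotKummerCompatHull` at
abc-iut-s2-p8's summand-route M-level sharp setting of the datum's OWN Θ- and q-ideles, read at the PINNED region operator
`ρ := fun _ => P.qRegion`, free `qK`). Proof: abc-iut-s2-p12's `GenuineMShrink2.cor312Of_of_SH` (p442072 ✓; inside it, by name: q-pin `rfl`
abc-iut-s2-p10 p440759, provenance abc-iut-w5-d244 p439939 ∘ abc-iut-w4-d013 p437121, `BridgeHyps` abc-iut-s2-p8 p438078, orbit-hull bound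
abc-iut-s2-p8 p440655 over abc-iut-s2-p7 p439554, Θ-side reading abc-iut-w5-d166 p438889) at `T.D`, `T.I`, `T.isVolumeInputOf`.
«Cor. 3.12 at these data follows from S_H AS TYPED» — no side taken on [IUTchIII] Cor. 3.12; S_H is an assumption label (refuted-as-typed at
deep data p438886, inhabited in the shallow tame window p439445); typed ≠ proved; instantiated ≠ endorsed. [claim: Mochizuki2012, status: disputed] -/
theorem GenuineMShrink2.cor312AtDatum_of_SH
    -- [S_H] the HULL-LEVEL form of the printed clause AT THE PINNED READING (ρ := the setting's own q-region), ADMISSIBLE (P,l) only — v10M's binder verbatim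
    (hSH : ∀ (P : NFPoint), P ∈ UP → ∀ (l : ℕ), l.Prime → 5 ≤ l →
      Cor22.AdmitsCore P → Cor22.CondP2 P l → Cor22.CondP5 P l → Cor22.CondP6 P l →
      ∀ (T : Cor22.ThetaVolumeDatumAt P l), letI := T.instFieldF; letI := T.instNumberFieldF; letI := T.instAlgebraF; letI := T.instFieldK;
        letI := T.instNumberFieldK; letI := T.instAlgebraK; letI := T.instFieldFbar; letI := T.instAlgebraFbar;
        letI := T.instAlgebraKFbar; letI := T.instIsElliptic;
      Cor312Vol.PilotKummerCompatHull
        (LatticeSituation.ofShells (logShellsOfInitialDH T.D (analyticLogvVal T.K)) (M P l T) (archPk P l T) (archSub P l T)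
          (summandPiecesPrM T.D (logvAnalyticVal_analyticLogvVal (K := T.K))).Adm
          (summandPiecesPrM T.D (logvAnalyticVal_analyticLogvVal (K := T.K))).logvol (Ψ P l T) (act P l T) (Mmod P l T)
          (region P l T) (frobAdm P l T) (frobLogvol P l T) (frobΨ P l T) (frobMmod P l T) (unitImage P l T) (ballImage P l T)
          (thetaDiv P l T))
        (settingPrVolSharpM T.D (logvAnalyticVal_analyticLogvVal (K := T.K)) (tOfIdeleData T.D (ideleDataOf T.D T.isVolumeInputOf))
          (fun u x => tqM T.D (ratChar u) u (natCast_ratChar_mem u) (ideleDataOf T.D T.isVolumeInputOf) x)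
          (M P l T) (archPk P l T) (archSub P l T) (Ψ P l T) (act P l T)
          (Mmod P l T) (region P l T) (n P l T) (lat P l T) (sig P l T) (split P l T) (qData P l T)
          (fun u x => tqM_ne_zero T.D (ratChar u) u (natCast_ratChar_mem u) (ideleDataOf T.D T.isVolumeInputOf) x)
          (GenuineM.finite_ratPlaces_under_S T.D).toFinset
          (fun u x hu => norm_tqM_eq_one_of_not_mem T.D (ratChar u) u (natCast_ratChar_mem u) (ideleDataOf T.D T.isVolumeInputOf) x
            fun hx => hu ((Set.Finite.mem_toFinset _).mpr ⟨x, hx⟩)))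
        (fun _ => Cor312.Setting.qRegion
        (settingPrVolSharpM T.D (logvAnalyticVal_analyticLogvVal (K := T.K)) (tOfIdeleData T.D (ideleDataOf T.D T.isVolumeInputOf))
          (fun u x => tqM T.D (ratChar u) u (natCast_ratChar_mem u) (ideleDataOf T.D T.isVolumeInputOf) x)
          (M P l T) (archPk P l T) (archSub P l T) (Ψ P l T) (act P l T)
          (Mmod P l T) (region P l T) (n P l T) (lat P l T) (sig P l T) (split P l T) (qData P l T)
          (fun u x => tqM_ne_zero T.D (ratChar u) u (natCast_ratChar_mem u) (ideleDataOf T.D T.isVolumeInputOf) x)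
          (GenuineM.finite_ratPlaces_under_S T.D).toFinset
          (fun u x hu => norm_tqM_eq_one_of_not_mem T.D (ratChar u) u (natCast_ratChar_mem u) (ideleDataOf T.D T.isVolumeInputOf) x
            fun hx => hu ((Set.Finite.mem_toFinset _).mpr ⟨x, hx⟩)))) (qK P l T)) :
    ∀ P : NFPoint, P ∈ UP → ∀ l : ℕ, l.Prime → 5 ≤ l →
      Cor22.AdmitsCore P → Cor22.CondP2 P l → Cor22.CondP5 P l → Cor22.CondP6 P l → Cor22.Cor312AtDatum P l := by
  intro P hP l hl h5 hc h2 h5' h6 T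
  letI := T.instFieldF; letI := T.instNumberFieldF; letI := T.instAlgebraF; letI := T.instFieldK
  letI := T.instNumberFieldK; letI := T.instAlgebraK; letI := T.instFieldFbar; letI := T.instAlgebraFbar
  letI := T.instAlgebraKFbar; letI := T.instIsElliptic
  exact GenuineMShrink2.cor312Of_of_SH T.D (M P l T) (archPk P l T) (archSub P l T) (Ψ P l T) (act P l T) (Mmod P l T)
    (region P l T) (frobAdm P l T) (frobLogvol P l T) (frobΨ P l T) (frobMmod P l T) (unitImage P l T) (ballImage P l T)
    (thetaDiv P l T) (n P l T) (lat P l T) (sig P l T) (split P l T) (qData P l T) (qK P l T) T.isVolumeInputOf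
    (hSH P hP l hl h5 hc h2 h5' h6 T)

/-! ## §2. The apexes: `ABC` from [S_H] per datum and ONE landed (P,l)-level cone input — 2 explicit hypotheses each -/

/-- **`abc_of_SH_v10M_szpiroSlack`** — v10M (`abc_of_SH_v10M`, abc-iut-s2-p12 p442072) with the CONE binder CUT from `hreg` to `hresSz` of
`Conditional/AbcOfSlackRegimeSzpiro.lean` (p436259): the hull estimate with `B_III(P,l)` ONLY at non-slot-constant data of points with `2 ≤ d_mod`
above abc-iut-c312-d1's explicit height threshold whose (Ind1) slot residue EXCEEDS abc-iut-s2-p1's Szpiro slack — the strongest landed cut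
(`hreg ⟹ habove ⟹ hresSz` as hypotheses: `slackRegime_of_hullRegime`, `szpiroSlackRegime_of_slackRegime`); the M-line twin of abc-iut-C-cert-2's
`abc_of_SH_v7K_szpiroSlack` (p440821). Explicit 2 = S_H 1 + CONE 1. Proof: `Conditional.ABC_of_cor312_of_szpiroSlackRegime` over §1.
«`ABC` follows from S_H + hresSz AS TYPED, at these data» — no side taken on [IUTchIII] Cor. 3.12; typed ≠ proved; instantiated ≠ endorsed.
[claim: Mochizuki2012, status: disputed] -/
theorem abc_of_SH_v10M_szpiroSlack
    -- [S_H] v10M's binder verbatim (pinned reading, admissible (P,l) only)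
    (hSH : ∀ (P : NFPoint), P ∈ UP → ∀ (l : ℕ), l.Prime → 5 ≤ l →
      Cor22.AdmitsCore P → Cor22.CondP2 P l → Cor22.CondP5 P l → Cor22.CondP6 P l →
      ∀ (T : Cor22.ThetaVolumeDatumAt P l), letI := T.instFieldF; letI := T.instNumberFieldF; letI := T.instAlgebraF; letI := T.instFieldK;
        letI := T.instNumberFieldK; letI := T.instAlgebraK; letI := T.instFieldFbar; letI := T.instAlgebraFbar;
        letI := T.instAlgebraKFbar; letI := T.instIsElliptic;
      Cor312Vol.PilotKummerCompatHull
        (LatticeSituation.ofShells (logShellsOfInitialDH T.D (analyticLogvVal T.K)) (M P l T) (archPk P l T) (archSub P l T)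
          (summandPiecesPrM T.D (logvAnalyticVal_analyticLogvVal (K := T.K))).Adm
          (summandPiecesPrM T.D (logvAnalyticVal_analyticLogvVal (K := T.K))).logvol (Ψ P l T) (act P l T) (Mmod P l T)
          (region P l T) (frobAdm P l T) (frobLogvol P l T) (frobΨ P l T) (frobMmod P l T) (unitImage P l T) (ballImage P l T)
          (thetaDiv P l T))
        (settingPrVolSharpM T.D (logvAnalyticVal_analyticLogvVal (K := T.K)) (tOfIdeleData T.D (ideleDataOf T.D T.isVolumeInputOf))
          (fun u x => tqM T.D (ratChar u) u (natCast_ratChar_mem u) (ideleDataOf T.D T.isVolumeInputOf) x)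
          (M P l T) (archPk P l T) (archSub P l T) (Ψ P l T) (act P l T)
          (Mmod P l T) (region P l T) (n P l T) (lat P l T) (sig P l T) (split P l T) (qData P l T)
          (fun u x => tqM_ne_zero T.D (ratChar u) u (natCast_ratChar_mem u) (ideleDataOf T.D T.isVolumeInputOf) x)
          (GenuineM.finite_ratPlaces_under_S T.D).toFinset
          (fun u x hu => norm_tqM_eq_one_of_not_mem T.D (ratChar u) u (natCast_ratChar_mem u) (ideleDataOf T.D T.isVolumeInputOf) x
            fun hx => hu ((Set.Finite.mem_toFinset _).mpr ⟨x, hx⟩)))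
        (fun _ => Cor312.Setting.qRegion
        (settingPrVolSharpM T.D (logvAnalyticVal_analyticLogvVal (K := T.K)) (tOfIdeleData T.D (ideleDataOf T.D T.isVolumeInputOf))
          (fun u x => tqM T.D (ratChar u) u (natCast_ratChar_mem u) (ideleDataOf T.D T.isVolumeInputOf) x)
          (M P l T) (archPk P l T) (archSub P l T) (Ψ P l T) (act P l T)
          (Mmod P l T) (region P l T) (n P l T) (lat P l T) (sig P l T) (split P l T) (qData P l T)
          (fun u x => tqM_ne_zero T.D (ratChar u) u (natCast_ratChar_mem u) (ideleDataOf T.D T.isVolumeInputOf) x)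
          (GenuineM.finite_ratPlaces_under_S T.D).toFinset
          (fun u x hu => norm_tqM_eq_one_of_not_mem T.D (ratChar u) u (natCast_ratChar_mem u) (ideleDataOf T.D T.isVolumeInputOf) x
            fun hx => hu ((Set.Finite.mem_toFinset _).mpr ⟨x, hx⟩)))) (qK P l T))
    -- [CONE] `hresSz` = `Conditional/AbcOfSlackRegimeSzpiro.lean`'s Szpiro-slack residue cut, verbatim
    (hresSz : ∀ P : NFPoint, P ∈ UP → ∀ l : ℕ, l.Prime → 5 ≤ l →
      Cor22.AdmitsCore P → Cor22.CondP2 P l → Cor22.CondP5 P l → Cor22.CondP6 P l →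
      2 ≤ Cor22.dmod P →
      40 * Real.log (((2 ^ 12 * 3 ^ 3 * 5 * Cor22.dmod P : ℕ) : ℝ) * l)
        * ((Nat.primeCounting (2 ^ 12 * 3 ^ 3 * 5 * Cor22.dmod P * l) : ℝ)
          - (2 * (Cor22.dmod P : ℝ) * (P.logDiff + Cor22.logCondAvoid P {2, l}) + Real.log (2 * 3 * 5 * (l : ℝ)))
            / Real.log 2) < Cor22.logQAvoid P {2, l} →
      ∀ T : Cor22.ThetaVolumeDatumAt P l,
        (letI := T.instFieldF; letI := T.instNumberFieldF; letI := T.instAlgebraF; letI := T.instFieldK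
         letI := T.instNumberFieldK; letI := T.instAlgebraK; letI := T.instFieldFbar; letI := T.instAlgebraFbar
         letI := T.instAlgebraKFbar; letI := T.instIsElliptic
         ¬ (∀ p ∈ T.I.supportPrimes, ∀ v w : placesOver (fieldOfModuli T.E) p,
            (Summit.ABC.IUTFork.DHData.ofInput T.I).logQloc p v = (Summit.ABC.IUTFork.DHData.ofInput T.I).logQloc p w)) →
        (letI := T.instFieldF; letI := T.instNumberFieldF; letI := T.instFieldK; letI := T.instNumberFieldK
         letI := T.instAlgebraK
         ((l : ℝ) + 1) / 4 * (4 * ((Cor22.dmod P : ℝ) - 1) / l * (P.logDiff + Cor22.logCondAvoid P {2, l})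
            + 20 / 3 * Real.log (((2 ^ 12 * 3 ^ 3 * 5 * Cor22.dmod P : ℕ) : ℝ) * l)
              * ((Nat.primeCounting (2 ^ 12 * 3 ^ 3 * 5 * Cor22.dmod P * l) : ℝ)
                - ((T.I.supportPrimes.filter (· ≤ 2 ^ 12 * 3 ^ 3 * 5 * Cor22.dmod P * l)).card : ℝ))) <
           T.I.X.slotResidue T.I.supportPrimes) →
        T.HullEstimateOf
          (((l : ℝ) + 1) / 4 *
            ((1 + 12 * (Cor22.dmod P : ℝ) / l) * (P.logDiff + Cor22.logCondAvoid P {2, l})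
              + 2 * Real.log l + 52
              + 20 / 3 * Real.log (((2 ^ 12 * 3 ^ 3 * 5 * Cor22.dmod P : ℕ) : ℝ) * (l : ℝ))
                * (Nat.primeCounting (2 ^ 12 * 3 ^ 3 * 5 * Cor22.dmod P * l) : ℝ)))) :
    _root_.ABC :=
  ABC_of_cor312_of_szpiroSlackRegime (GenuineMShrink2.cor312AtDatum_of_SH (hSH := hSH)) hresSz

/-- **`abc_of_SH_v10M_szpiroSuff`** — v10M with the CONE binder replaced by abc-iut-s2-p1's DATUM-FREE Szpiro-type inequality at `d_mod ≥ 2`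
(`Conditional/AbcOfSHvolSzpiroSuff.lean`, `hSz` verbatim: `log(q^{∤{2,l}}(λ)) ≤ (24(d_mod−1)/l)·(log-diff + log-cond) + 40·log(d*·l)·max(0, …)`;
`d_mod = 1` is abc-iut-S3's pinned theorem, inside). Explicit 2 = S_H 1 + CONE 1, the cone input now a statement about `λ` and `l` only — of
the same TYPE as the conclusion. Proof: `Conditional.ABC_of_cor312_of_szpiroSuff` over §1. «`ABC` follows from S_H + hSz AS TYPED, at these
data» — nothing asserted about either hypothesis; no side taken on [IUTchIII] Cor. 3.12; typed ≠ proved. [claim: Mochizuki2012, status: disputed] -/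
theorem abc_of_SH_v10M_szpiroSuff
    -- [S_H] v10M's binder verbatim (pinned reading, admissible (P,l) only)
    (hSH : ∀ (P : NFPoint), P ∈ UP → ∀ (l : ℕ), l.Prime → 5 ≤ l →
      Cor22.AdmitsCore P → Cor22.CondP2 P l → Cor22.CondP5 P l → Cor22.CondP6 P l →
      ∀ (T : Cor22.ThetaVolumeDatumAt P l), letI := T.instFieldF; letI := T.instNumberFieldF; letI := T.instAlgebraF; letI := T.instFieldK;
        letI := T.instNumberFieldK; letI := T.instAlgebraK; letI := T.instFieldFbar; letI := T.instAlgebraFbar;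
        letI := T.instAlgebraKFbar; letI := T.instIsElliptic;
      Cor312Vol.PilotKummerCompatHull
        (LatticeSituation.ofShells (logShellsOfInitialDH T.D (analyticLogvVal T.K)) (M P l T) (archPk P l T) (archSub P l T)
          (summandPiecesPrM T.D (logvAnalyticVal_analyticLogvVal (K := T.K))).Adm
          (summandPiecesPrM T.D (logvAnalyticVal_analyticLogvVal (K := T.K))).logvol (Ψ P l T) (act P l T) (Mmod P l T)
          (region P l T) (frobAdm P l T) (frobLogvol P l T) (frobΨ P l T) (frobMmod P l T) (unitImage P l T) (ballImage P l T)
          (thetaDiv P l T))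
        (settingPrVolSharpM T.D (logvAnalyticVal_analyticLogvVal (K := T.K)) (tOfIdeleData T.D (ideleDataOf T.D T.isVolumeInputOf))
          (fun u x => tqM T.D (ratChar u) u (natCast_ratChar_mem u) (ideleDataOf T.D T.isVolumeInputOf) x)
          (M P l T) (archPk P l T) (archSub P l T) (Ψ P l T) (act P l T)
          (Mmod P l T) (region P l T) (n P l T) (lat P l T) (sig P l T) (split P l T) (qData P l T)
          (fun u x => tqM_ne_zero T.D (ratChar u) u (natCast_ratChar_mem u) (ideleDataOf T.D T.isVolumeInputOf) x)
          (GenuineM.finite_ratPlaces_under_S T.D).toFinset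
          (fun u x hu => norm_tqM_eq_one_of_not_mem T.D (ratChar u) u (natCast_ratChar_mem u) (ideleDataOf T.D T.isVolumeInputOf) x
            fun hx => hu ((Set.Finite.mem_toFinset _).mpr ⟨x, hx⟩)))
        (fun _ => Cor312.Setting.qRegion
        (settingPrVolSharpM T.D (logvAnalyticVal_analyticLogvVal (K := T.K)) (tOfIdeleData T.D (ideleDataOf T.D T.isVolumeInputOf))
          (fun u x => tqM T.D (ratChar u) u (natCast_ratChar_mem u) (ideleDataOf T.D T.isVolumeInputOf) x)
          (M P l T) (archPk P l T) (archSub P l T) (Ψ P l T) (act P l T)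
          (Mmod P l T) (region P l T) (n P l T) (lat P l T) (sig P l T) (split P l T) (qData P l T)
          (fun u x => tqM_ne_zero T.D (ratChar u) u (natCast_ratChar_mem u) (ideleDataOf T.D T.isVolumeInputOf) x)
          (GenuineM.finite_ratPlaces_under_S T.D).toFinset
          (fun u x hu => norm_tqM_eq_one_of_not_mem T.D (ratChar u) u (natCast_ratChar_mem u) (ideleDataOf T.D T.isVolumeInputOf) x
            fun hx => hu ((Set.Finite.mem_toFinset _).mpr ⟨x, hx⟩)))) (qK P l T))
    -- [CONE] abc-iut-s2-p1's datum-free Szpiro-type sufficient condition at `d_mod ≥ 2`, verbatim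
    (hSz : ∀ P : NFPoint, P ∈ UP → ∀ l : ℕ, l.Prime → 5 ≤ l →
      Cor22.AdmitsCore P → Cor22.CondP2 P l → Cor22.CondP5 P l → Cor22.CondP6 P l → 2 ≤ Cor22.dmod P →
      Cor22.logQAvoid P {2, l} ≤
        24 * ((Cor22.dmod P : ℝ) - 1) / l * (P.logDiff + Cor22.logCondAvoid P {2, l})
        + 40 * Real.log (((2 ^ 12 * 3 ^ 3 * 5 * Cor22.dmod P : ℕ) : ℝ) * l)
          * max 0 (((Nat.primeCounting (2 ^ 12 * 3 ^ 3 * 5 * Cor22.dmod P * l) : ℝ)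
            - (2 * (Cor22.dmod P : ℝ) * (P.logDiff + Cor22.logCondAvoid P {2, l}) + Real.log (2 * 3 * 5 * (l : ℝ)))
              / Real.log 2))) :
    _root_.ABC :=
  ABC_of_cor312_of_szpiroSuff (GenuineMShrink2.cor312AtDatum_of_SH (hSH := hSH)) hSz

open scoped Classical in
/-- **`abc_of_SH_v10M_pointMixedSzpiro`** — v10M with the CONE binder replaced by abc-iut-s2-p1's DATUM-FREE mixed-height Szpiro-type bound
`hMix` (`LDHGenuineHullRegimeMixedPoint.lean` p438083, TRADE 6 of the s2 SCOREBOARD; verbatim, same `Classical` decidability context): at every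
admissible `(λ, l)` a finite set of primes containing the unequal-local-heights primes of `j(λ)` over `ℚ(j(λ))`, whose weighted `{2,l}`-avoiding
local heights are bounded by the Szpiro-max slack. Explicit 2 = S_H 1 + CONE 1. Proof: `Conditional.ABC_of_cor312_of_pointMixedSzpiro` over §1.
«`ABC` follows from S_H + hMix AS TYPED, at these data» — nothing asserted about either hypothesis; no side taken on [IUTchIII] Cor. 3.12;
typed ≠ proved; instantiated ≠ endorsed. [claim: Mochizuki2012, status: disputed] -/
theorem abc_of_SH_v10M_pointMixedSzpiro
    -- [S_H] v10M's binder verbatim (pinned reading, admissible (P,l) only)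
    (hSH : ∀ (P : NFPoint), P ∈ UP → ∀ (l : ℕ), l.Prime → 5 ≤ l →
      Cor22.AdmitsCore P → Cor22.CondP2 P l → Cor22.CondP5 P l → Cor22.CondP6 P l →
      ∀ (T : Cor22.ThetaVolumeDatumAt P l), letI := T.instFieldF; letI := T.instNumberFieldF; letI := T.instAlgebraF; letI := T.instFieldK;
        letI := T.instNumberFieldK; letI := T.instAlgebraK; letI := T.instFieldFbar; letI := T.instAlgebraFbar;
        letI := T.instAlgebraKFbar; letI := T.instIsElliptic;
      Cor312Vol.PilotKummerCompatHull
        (LatticeSituation.ofShells (logShellsOfInitialDH T.D (analyticLogvVal T.K)) (M P l T) (archPk P l T) (archSub P l T)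
          (summandPiecesPrM T.D (logvAnalyticVal_analyticLogvVal (K := T.K))).Adm
          (summandPiecesPrM T.D (logvAnalyticVal_analyticLogvVal (K := T.K))).logvol (Ψ P l T) (act P l T) (Mmod P l T)
          (region P l T) (frobAdm P l T) (frobLogvol P l T) (frobΨ P l T) (frobMmod P l T) (unitImage P l T) (ballImage P l T)
          (thetaDiv P l T))
        (settingPrVolSharpM T.D (logvAnalyticVal_analyticLogvVal (K := T.K)) (tOfIdeleData T.D (ideleDataOf T.D T.isVolumeInputOf))
          (fun u x => tqM T.D (ratChar u) u (natCast_ratChar_mem u) (ideleDataOf T.D T.isVolumeInputOf) x)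
          (M P l T) (archPk P l T) (archSub P l T) (Ψ P l T) (act P l T)
          (Mmod P l T) (region P l T) (n P l T) (lat P l T) (sig P l T) (split P l T) (qData P l T)
          (fun u x => tqM_ne_zero T.D (ratChar u) u (natCast_ratChar_mem u) (ideleDataOf T.D T.isVolumeInputOf) x)
          (GenuineM.finite_ratPlaces_under_S T.D).toFinset
          (fun u x hu => norm_tqM_eq_one_of_not_mem T.D (ratChar u) u (natCast_ratChar_mem u) (ideleDataOf T.D T.isVolumeInputOf) x
            fun hx => hu ((Set.Finite.mem_toFinset _).mpr ⟨x, hx⟩)))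
        (fun _ => Cor312.Setting.qRegion
        (settingPrVolSharpM T.D (logvAnalyticVal_analyticLogvVal (K := T.K)) (tOfIdeleData T.D (ideleDataOf T.D T.isVolumeInputOf))
          (fun u x => tqM T.D (ratChar u) u (natCast_ratChar_mem u) (ideleDataOf T.D T.isVolumeInputOf) x)
          (M P l T) (archPk P l T) (archSub P l T) (Ψ P l T) (act P l T)
          (Mmod P l T) (region P l T) (n P l T) (lat P l T) (sig P l T) (split P l T) (qData P l T)
          (fun u x => tqM_ne_zero T.D (ratChar u) u (natCast_ratChar_mem u) (ideleDataOf T.D T.isVolumeInputOf) x)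
          (GenuineM.finite_ratPlaces_under_S T.D).toFinset
          (fun u x hu => norm_tqM_eq_one_of_not_mem T.D (ratChar u) u (natCast_ratChar_mem u) (ideleDataOf T.D T.isVolumeInputOf) x
            fun hx => hu ((Set.Finite.mem_toFinset _).mpr ⟨x, hx⟩)))) (qK P l T))
    -- [CONE] abc-iut-s2-p1's datum-free mixed-height Szpiro-type bound, verbatim
    (hMix : ∀ P : NFPoint, P ∈ UP → ∀ l : ℕ, l.Prime → 5 ≤ l →
      Cor22.AdmitsCore P → Cor22.CondP2 P l → Cor22.CondP5 P l → Cor22.CondP6 P l →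
      ∃ M : Finset ℕ,
        (∀ p : ℕ, p.Prime →
          (¬ ∀ V W : HeightOneSpectrum (𝓞 ↥(IntermediateField.adjoin ℚ ({Cor22.jInv P.x} : Set P.F))),
            V ∈ placesOver _ p → W ∈ placesOver _ p →
            (if ord _ V (Cor22.jMod P) < 0 ∧ ((2 : ℕ) : 𝓞 _) ∉ V.asIdeal ∧ ((l : ℕ) : 𝓞 _) ∉ V.asIdeal
              then ((-ord _ V (Cor22.jMod P) : ℤ) : ℝ) * logNorm _ V / (localDegree _ V : ℝ) else 0) =
            (if ord _ W (Cor22.jMod P) < 0 ∧ ((2 : ℕ) : 𝓞 _) ∉ W.asIdeal ∧ ((l : ℕ) : 𝓞 _) ∉ W.asIdeal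
              then ((-ord _ W (Cor22.jMod P) : ℤ) : ℝ) * logNorm _ W / (localDegree _ W : ℝ) else 0)) → p ∈ M) ∧
        ((l : ℝ) + 1) / 24 *
            ∑ p ∈ M, ∑ V : placesOver ↥(IntermediateField.adjoin ℚ ({Cor22.jInv P.x} : Set P.F)) p,
              (if ord _ V.1 (Cor22.jMod P) < 0 ∧ ((2 : ℕ) : 𝓞 _) ∉ V.1.asIdeal ∧ ((l : ℕ) : 𝓞 _) ∉ V.1.asIdeal then
                weight _ V.1 * (((-ord _ V.1 (Cor22.jMod P) : ℤ) : ℝ) * logNorm _ V.1 / (localDegree _ V.1 : ℝ))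
               else 0) ≤
          ((l : ℝ) + 1) / 4 * (4 * ((Cor22.dmod P : ℝ) - 1) / l * (P.logDiff + Cor22.logCondAvoid P {2, l})
            + 20 / 3 * Real.log (((2 ^ 12 * 3 ^ 3 * 5 * Cor22.dmod P : ℕ) : ℝ) * l)
              * max 0 (((Nat.primeCounting (2 ^ 12 * 3 ^ 3 * 5 * Cor22.dmod P * l) : ℝ)
                - (2 * (Cor22.dmod P : ℝ) * (P.logDiff + Cor22.logCondAvoid P {2, l}) + Real.log (2 * 3 * 5 * (l : ℝ)))
                  / Real.log 2)))) :
    _root_.ABC :=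
  ABC_of_cor312_of_pointMixedSzpiro (GenuineMShrink2.cor312AtDatum_of_SH (hSH := hSH)) hMix

end Family

end Summit.ABC.IUTFork.Conditional

end
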